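import Summits.Ventures.CertifiedManyBodySolver.Theses.CovLa214M2b
import Summits.Ventures.CertifiedManyBodySolver.Theorems.CovLa214M2bSegmentFanOfShortInner
import Summits.Ventures.CertifiedManyBodySolver.Downfold.BoxesLa214V115M2bBoxReadSplits
import HarnessLib

/-!
# Crux `CovLa214M2b.SegmentFanCeiling` (stmt-Ventures-26183) — BIRTH SKELETON (BC3 line «birth»)

Route pen hubbard-m2-certneg-1 (planner, cell `pub/hubbard-obs`). The crux K1 = the SEGMENT-FAN shadow of the La214-E box
`[−3/10, −1/5] × [29/5, 74/5] × {1}`: every target `(t′, U)` whose apex source at the f-sum station `U = 29/5` stays in the box,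
`−3/10 ≤ t′(2 − (29/5)/U)`, carries `ObsStiffnessSeqCeilingAt t′ U 1 (4364687/10⁷)`.

LINE OF RECORD (E1 inner half-bundle A; captain LA214-COVERAGE-PLAN; BoxRead typing of hubbard-cov-la214-box-1): the kinematic slab
`t′ ≥ −13/50` is node-free (`SegmentFanCeiling_of_strip`), so K1's many-body content is ONE station object, the own-word `boxdual/0`
read of the INNER HALF-BUNDLE A `s ∈ [−3/10, −1/4] × {29/5}` (vertices kit j298764 at `−3/10`, word 0.3870869, and kit j299799 at `−1/4`).
A boxdual read certifies a row GIVEN an a-priori energy window; the window is a separate certified object (energy legs: the `K₂`-diagonal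
bootstraps A₁/A₂ for the chord floor, the Mott column #21/#487/#427/#488 for the cap). Hence TWO stubs, two producers:

* `stub_stationWindowA` — the energy WINDOW of half-bundle A: chord floor `bundleChordFloor (−3/10) (−1/4) f(−3/10) f(−1/4) ≤ e(1,s,29/5,1) ≤ HI29`
  on `[−3/10, −1/4]` (in tree only modulo the claim nodes j295983/j295889/#21/#487/#427/#488: `laBoxE_innerHalfBundles_floor_of`, `laBoxE_u29o5_cap_of`);
* `stub_innerHalfRowA_underBar` — the boxdual ROW of half-bundle A in the claim-node shape `TPrimeBundleOrbitLowerRow` with SOME certified uniform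
  value `F`, `−F ≤ 4364687/10⁷` (the producer deliverable; not in tree);
* `SegmentFanCeiling_of` — the kernel-checked composition (row + window ⇒ unconditional own-word family on `[−3/10, −1/4] ⊇ [−3/10, −13/50]` ⇒
  `segmentFanCeiling_of_shortInnerFamily`), concluding the route decl BY NAME.

HONEST FRAMING: a skeleton, not a proof — the two `stub_*` carry `sorry` by design; stiffness CEILINGS on a downfolded box = CONTROL/CALIBRATION +
labelled heuristic, silent on `ρ_s = 0`, never «certified true negative»; no number of record, no certificate, no phase sentence; no summit
statement is proved by this seat.
-/

noncomputable section

namespace Summit.Ventures.CertifiedManyBodySolver.Cruxes.SegmentFanCeiling.Birth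

open Set Filter Topology
open Summit.Ventures.CertifiedManyBodySolver.Theses.CovLa214M2b
open Summit.Ventures.CertifiedManyBodySolver.Observables
open Summit.Ventures.CertifiedManyBodySolver.Downfold
open Summit.Ventures.CertifiedManyBodySolver.Theorems
open Literature.MathematicalPhysics.QuantumLattice Literature.MathematicalPhysics.QuantumLattice.ThermodynamicLimit
open Literature.Probability.LatticeModels
open Matrix HubbardWave0
open scoped BigOperators ComplexOrder

/-- **Stub 1 statement — the ENERGY WINDOW of the inner half-bundle A** `[−3/10, −1/4] × {29/5}`, `n = 1`: the declared chord floor of the two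
vertex floors `f(−3/10)`, `f(−1/4)` (A₂-law bootstraps of the `K₂`-diagonal legs) is below, and the `t′`-free Mott-column cap `HI29` is above,
the ground-state energy density `e(1, s, 29/5, 1)` at every `s` of the segment. [cite: Griffiths1966, §II] -/
def StationWindowA : Prop :=
  ∀ s ∈ Set.Icc (-3 / 10 : ℝ) (-1 / 4),
    bundleChordFloor (-3 / 10) (-1 / 4) laBoxE_f3o10 laBoxE_f1o4 s ≤ energyDensityTT' 1 s (29 / 5) 1 ∧
      energyDensityTT' 1 s (29 / 5) 1 ≤ ((laBoxE_HI29 : ℚ) : ℝ)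

/-- **Stub 2 statement — the boxdual ROW of the inner half-bundle A under the bar**: some certified uniform value `F` with `−F ≤ 4364687/10⁷`
for the own objective `−X₀(s)` in the bundle claim-node shape (for every `s ∈ [−3/10, −1/4]`, given the declared floor, the `D₄`-orbit-mean lower
row with cap `HI29`). [cite: BoydVandenberghe2004, §5.9] [cite: ScalapinoWhiteZhang1993, §II] -/
def InnerHalfRowAUnderBar : Prop :=
  ∃ F : ℚ, -F ≤ 4364687 / 10000000 ∧
    TPrimeBundleOrbitLowerRow (29 / 5) 1 (-3 / 10) (-1 / 4) laBoxE_f3o10 laBoxE_f1o4 laBoxE_HI29 F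
      (fun s => -oddMomentObsTT s (29 / 5) 0)


/-! ## Helper for the holder (proved): the captain's S1 object (the FULL inner row on `[−3/10, −1/5]`, floors `f(−3/10)`, `f(−1/5)`) implies stub 2 —
`f(−1/4)` is by definition the chord midpoint, so the two declared floors agree on `[−3/10, −1/4]`. -/

/-- The half-bundle-A chord floor IS the inner-bundle chord floor (the split vertex floor `laBoxE_f1o4` is the midpoint of `laBoxE_f3o10`, `laBoxE_f1o5`
on the A₂ line). [folklore] -/
theorem bundleChordFloor_innerHalfA_eq (s : ℝ) :
    bundleChordFloor (-3 / 10) (-1 / 4) laBoxE_f3o10 laBoxE_f1o4 s =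
      bundleChordFloor (-3 / 10) (-1 / 5) laBoxE_f3o10 laBoxE_f1o5 s := by
  simp only [bundleChordFloor, laBoxE_f1o4, laBoxE_f3o10, laBoxE_f1o5]
  push_cast
  ring

/-- **S1's full inner row under the bar ⇒ stub 2** (restriction to the left half; same floor, same cap, same objective). [cite: BoydVandenberghe2004, §5.9] -/
theorem innerHalfRowAUnderBar_of_innerRowUnderBar
    (h : ∃ F : ℚ, -F ≤ 4364687 / 10000000 ∧
      TPrimeBundleOrbitLowerRow (29 / 5) 1 (-3 / 10) (-1 / 5) laBoxE_f3o10 laBoxE_f1o5 laBoxE_HI29 F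
        (fun s => -oddMomentObsTT s (29 / 5) 0)) :
    InnerHalfRowAUnderBar := by
  obtain ⟨F, hF, hrow⟩ := h
  refine ⟨F, hF, fun s hs hfl => hrow s ⟨hs.1, hs.2.trans (by norm_num)⟩ ?_⟩
  rwa [bundleChordFloor_innerHalfA_eq] at hfl

/-- **STUB 1 (energy legs; size M: two `K₂`-diagonal bootstraps + the Mott-column window, referee/reader-B discharge of six claim nodes).**
[cite: Griffiths1966, §II] -/
theorem stub_stationWindowA : StationWindowA := by
  sorry

/-- **STUB 2 (the producer deliverable; size L: one `boxdual/0` light read of half-bundle A with its exact rational `F0 ≥ −0.4364687`, then the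
claim node and its reader-B/referee legs).** [cite: BoydVandenberghe2004, §5.9] -/
theorem stub_innerHalfRowA_underBar : InnerHalfRowAUnderBar := by
  sorry

/-- **COMPOSITION (kernel-checked, no `sorry` of its own): window + row ⇒ `SegmentFanCeiling`.** The row read against the discharged window is an
unconditional own-word orbit-lower family with the constant value `F` on `[−3/10, −1/4] ⊇ [−3/10, −13/50]`; `segmentFanCeiling_of_shortInnerFamily`
(one-station apex transport + the node-free kinematic slab `t′ ≥ −13/50`) closes the crux. [cite: KomaTasaki1994, §1] [cite: ScalapinoWhiteZhang1993, §II] -/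
theorem SegmentFanCeiling_of (hW : StationWindowA) (hR : InnerHalfRowAUnderBar) :
    Summit.Ventures.CertifiedManyBodySolver.Theses.CovLa214M2b.SegmentFanCeiling := by
  obtain ⟨F, hF, hrow⟩ := hR
  have hfam := hrow.orbitLower (fun s hs => (hW s hs).1) (fun s hs => (hW s hs).2)
  refine segmentFanCeiling_of_shortInnerFamily (fun _ => ((F : ℚ) : ℝ))
    (fun s hs => hfam s ⟨hs.1, hs.2.trans (by norm_num)⟩) (fun s _ => ?_)
  exact_mod_cast hF

/-- The skeleton decides the crux from its two stubs (the line's shape, for the record). -/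
theorem SegmentFanCeiling_of_stubs : Summit.Ventures.CertifiedManyBodySolver.Theses.CovLa214M2b.SegmentFanCeiling :=
  SegmentFanCeiling_of stub_stationWindowA stub_innerHalfRowA_underBar

end Summit.Ventures.CertifiedManyBodySolver.Cruxes.SegmentFanCeiling.Birth

end
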